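/-
Copyright: cell `pub-ymgap` (HUMAN RULING D-0062), Track A of `YM-PLAN.md`, DAG node N20 (= NE7b); R134 acceleration seat
`pub-ymgap-dag-n20-c` (strategy s1, generation 0), module 3.  Released under the licence of the surrounding project.
-/
import Literature.MathematicalPhysics.QuantumFieldTheory.Balaban1983to89.Node00.TStepOfRecord
import HarnessLib

/-!
# YM-DAG node N20 (= NE7b), strategy s1, module 3: WHERE THE (α)-INSTANCE MEETS THE RECORD — «LCS-j» for a (2.18)-piece of
# NODE 00's T-step of record IS a fine-level weighted moment of the coarse carrier composed with Bałaban's block average of record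

Track A of `YM-PLAN.md` (cell `pub-ymgap`, HUMAN RULING D-0062), node **N20** = spine estimate NE7b (`T4WeightBudget.RelWeightBound` —
the cell `pub-balaban`'s OWN estimate, NOT PRINTED in [Bałaban 1983–89], NOT PROVED).  Seat `pub-ymgap-dag-n20-c` (R134, s1), module 3
(modules 1–2: `…Theorems.BalabanUVNodesN20LCSPushforward` p453912, `…Theorems.BalabanUVNodesN20LCSLoopEnergies`).  Kernel theorems only:
0 `def`, 0 `sorry`, standard axioms; COUNT-NEUTRAL; `--supports` the K3 item `SpineGivenEndpointR11` (stmt-QuantumFields-19676).  Nothing of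
Bałaban's is asserted: the objects are NODE 00 ₇b∕₉'s (`Node00.TStepOfRecord`, def-T FILE 1: the value-level T-step `texpASucc` ∕
`tstepOfRecord` = the one-step disintegration transport of the weighted, pinned fine piece), read BY NAME.

WHY (dag-n20-e LOCATED N20∕s2 l.12292: «s1: this is where your (α)-instance meets the record»).  Module 1 §1 proved, for a PLAIN transported
density `T ρ = kernelTransport ν μ avg ρ`, that the `LocCondStability` inequality at the averaged level is the fine-level moment of `M ∘ avg`.
NODE 00's T-step carries the step WEIGHTS `w(s′)(U, V′)` INSIDE the kernel ((†): `(𝐓e^A)_{k+1}(s′)(V′) = h(V′)·∫ w(s′)(U,V′)·χ_k(init s′)(U)·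
(𝐓e^A)_k(init s′)(U) κ_{V′}(dU)`), so the plain form does not literally apply.  THIS FILE proves the graph form: for every bounded measurable
coarse carrier `M`, every level `k`, every new sequence `s′`,
`∫ M(V′)·χ_{k+1}(s′)(V′)·(𝐓e^A)_{k+1}(s′)(V′) dV′ = ∫ M(Ū)·[χ_{k+1}(s′)(Ū)·w(s′)(U,Ū)]·χ_k(init s′)(U)·(𝐓e^A)_k(init s′)(U) dU`
(`Ū = avg U`; the tree's `integral_transport_piece` = `integral_graph_eq` on the graph `V′ = Ū`).  Hence «LCS-j» FOR THE LEVEL-`(k+1)` PIECE OF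
THE REPRESENTED TOWER — `∫ M·piece ≤ e^{b}·∫ piece` — IS the fine-level moment bound of `M ∘ avg` against the PINNED FINE DENSITY
`χ_{k+1}(s′)(Ū)·w(s′)(U,Ū)·χ_k(init s′)(U)·(𝐓e^A)_k(init s′)(U)` (`lcs_piece_iff_fine`), at EVERY level `k` and for the PRE-𝐑 pieces verbatim
(`Node00.RepTowerOfRecord.slotsTOfRecord` ∕ `trhoOfRecord9` are assembled from exactly these pieces); and a carrier bound ON THE SUPPORT of the
pinned fine density suffices (`lcs_piece_of_carrier_le_on_support` — the new front factor `χ_{k+1}(s′)(Ū)` restricts the averaged field to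
the sequence's small-field domains, so nothing is asked off them: the record-level twin of `…NE7b.CarrierOnSupport`).  §2 specialises to
the objects OF RECORD (`G = SU(N)`, `avOfRecord`, `chiSeqOfRecord`, `tstepOfRecord`, `k < K`).

NOT HERE (honest).  The moment bound itself for Bałaban's densities (module 2 discharges it for DECIMATION ∕ loop energies under the bare measure;
for `avOfRecord` the domination letter is located residual (i) of module 1; the conditional∕restricted form is (ii)); the POST-𝐑 pieces (the
𝐑-step of record `rstepSlotOfRecord` acts on slots — (A1c)'s quotients, residual (iv)).  NE7b NOT PRINTED ∕ NOT PROVED; (α)-instance 0∕1;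
N20 NOT discharged; typed 28∕28, discharged count untouched; one finite four-torus at fixed `ε` — NOT ℝ⁴, NOT infinite volume, NOT OS, NOT a
mass gap, NOT Clay.
-/

set_option autoImplicit false

noncomputable section

namespace Summit.QuantumFields.YangMills.BalabanUVNodes.N20LCSAtTStepOfRecord

open MeasureTheory
open Literature.MathematicalPhysics.QuantumFieldTheory.Balaban1983to89
open Literature.MathematicalPhysics.QuantumFieldTheory.Balaban1983to89.T4Continuum
open Literature.MathematicalPhysics.QuantumFieldTheory.Balaban1983to89.T4AveragingDisintegration (avgDensity avgKernel)
open Literature.MathematicalPhysics.QuantumFieldTheory.Balaban1983to89.Node00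
open Literature.MathematicalPhysics.QuantumFieldTheory.Balaban1983to89.T4FiniteEpsInhabited
open B14.Eq218Concrete

/-! ## §1 Generic: a coarse carrier against a (2.18)-piece of the value-level T-step -/

section Generic

variable {P : Params} {G : Type*} [GaugeGroup G] [MeasurableSpace G] [HaarData G] [StandardBorelSpace G]
variable {α : Type*} {D : ℕ → Set (Set α)} {k : ℕ} {avg : GaugeField P k G → GaugeField P (k + 1) G}

/-- **A COARSE CARRIER AGAINST A PIECE OF THE T-STEP IS THE COMPOSED CARRIER AGAINST THE PINNED FINE DENSITY** (graph form of the
push-forward identity, weights inside the kernel): for a bounded measurable `M` on the coarse fields, a new sequence `s′`, an integrable old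
piece `χ_k(init s′)·T(init s′)`, a bounded jointly measurable weight `w(s′)` and a bounded measurable new front factor `χ_{k+1}(s′)`,
`∫ M(V′)·χ_{k+1}(s′)(V′)·texpASucc(s′)(V′) dV′ = ∫ M(Ū)·(χ_{k+1}(s′)(Ū)·w(s′)(U,Ū))·(χ_k(init s′)(U)·T(init s′)(U)) dU`. [folklore] -/
theorem integral_mul_piece_texpASucc (havg : Measurable avg) (hac : HaarAC avg) (χk T : Seq D k → Density P k G)
    (χk1 : Seq D (k + 1) → Density P (k + 1) G) (w : Seq D (k + 1) → GaugeField P k G → GaugeField P (k + 1) G → ℝ)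
    (s' : Seq D (k + 1)) (hT : Integrable (fun U => χk s'.init U * T s'.init U) (fieldMeasure P k G))
    (hw : Measurable (fun z : GaugeField P (k + 1) G × GaugeField P k G => w s' z.2 z.1))
    (hwb : ∀ U V', |w s' U V'| ≤ 1) (hχ : Measurable (χk1 s')) (hχb : ∀ V', |χk1 s' V'| ≤ 1)
    {M : GaugeField P (k + 1) G → ℝ} (hM : Measurable M) {C : ℝ} (hMC : ∀ V', |M V'| ≤ C) :
    ∫ V', M V' * (χk1 s' V' * texpASucc avg χk T w s' V') ∂(fieldMeasure P (k + 1) G) =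
      ∫ U, M (avg U) * (χk1 s' (avg U) * w s' U (avg U)) * (χk s'.init U * T s'.init U) ∂(fieldMeasure P k G) := by
  have hb : Measurable (fun z : GaugeField P (k + 1) G × GaugeField P k G => w s' z.2 z.1 * (χk1 s' z.1 * M z.1)) :=
    hw.mul ((hχ.comp measurable_fst).mul (hM.comp measurable_fst))
  have hbC : ∀ z : GaugeField P (k + 1) G × GaugeField P k G, ‖w s' z.2 z.1 * (χk1 s' z.1 * M z.1)‖ ≤ C := by
    intro z
    rw [Real.norm_eq_abs, abs_mul, abs_mul]
    calc |w s' z.2 z.1| * (|χk1 s' z.1| * |M z.1|) ≤ 1 * (1 * C) :=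
          mul_le_mul (hwb _ _) (mul_le_mul (hχb _) (hMC _) (abs_nonneg _) zero_le_one)
            (mul_nonneg (abs_nonneg _) (abs_nonneg _)) zero_le_one
      _ = C := by ring
  have key := integral_transport_piece havg hac hT hb hbC
  -- the left integrand IS the transported piece with cofactor `w·(χ_{k+1}·M)`
  have e : ∀ V, M V * (χk1 s' V * texpASucc avg χk T w s' V) =
      (avgDensity avg V : ℝ) * ∫ U, (χk s'.init U * T s'.init U) * (w s' U V * (χk1 s' V * M V)) ∂(avgKernel avg V) := by
    intro V
    have : ∫ U, (χk s'.init U * T s'.init U) * (w s' U V * (χk1 s' V * M V)) ∂(avgKernel avg V)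
        = (∫ U, w s' U V * (χk s'.init U * T s'.init U) ∂(avgKernel avg V)) * (χk1 s' V * M V) := by
      rw [← integral_mul_const]
      refine integral_congr_ae (ae_of_all _ fun U => ?_)
      ring
    rw [this, texpASucc_apply]
    ring
  calc ∫ V', M V' * (χk1 s' V' * texpASucc avg χk T w s' V') ∂(fieldMeasure P (k + 1) G)
      = ∫ V, (avgDensity avg V : ℝ) *
          ∫ U, (χk s'.init U * T s'.init U) * (w s' U V * (χk1 s' V * M V)) ∂(avgKernel avg V) ∂(fieldMeasure P (k + 1) G) :=
        integral_congr_ae (ae_of_all _ e)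
    _ = ∫ U, (χk s'.init U * T s'.init U) * (w s' U (avg U) * (χk1 s' (avg U) * M (avg U))) ∂(fieldMeasure P k G) := key
    _ = ∫ U, M (avg U) * (χk1 s' (avg U) * w s' U (avg U)) * (χk s'.init U * T s'.init U) ∂(fieldMeasure P k G) :=
        integral_congr_ae (ae_of_all _ fun U => by ring)

/-- The total mass of a piece: `∫ χ_{k+1}(s′)·texpASucc(s′) dV′ = ∫ (χ_{k+1}(s′)(Ū)·w(s′)(U,Ū))·(χ_k(init s′)(U)·T(init s′)(U)) dU`
(the carrier `1`). [folklore] -/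
theorem integral_piece_texpASucc (havg : Measurable avg) (hac : HaarAC avg) (χk T : Seq D k → Density P k G)
    (χk1 : Seq D (k + 1) → Density P (k + 1) G) (w : Seq D (k + 1) → GaugeField P k G → GaugeField P (k + 1) G → ℝ)
    (s' : Seq D (k + 1)) (hT : Integrable (fun U => χk s'.init U * T s'.init U) (fieldMeasure P k G))
    (hw : Measurable (fun z : GaugeField P (k + 1) G × GaugeField P k G => w s' z.2 z.1))
    (hwb : ∀ U V', |w s' U V'| ≤ 1) (hχ : Measurable (χk1 s')) (hχb : ∀ V', |χk1 s' V'| ≤ 1) :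
    ∫ V', χk1 s' V' * texpASucc avg χk T w s' V' ∂(fieldMeasure P (k + 1) G) =
      ∫ U, (χk1 s' (avg U) * w s' U (avg U)) * (χk s'.init U * T s'.init U) ∂(fieldMeasure P k G) := by
  have h := integral_mul_piece_texpASucc havg hac χk T χk1 w s' hT hw hwb hχ hχb (M := fun _ => (1 : ℝ)) measurable_const
    (C := 1) (fun _ => by simp)
  simpa only [one_mul] using h

omit [StandardBorelSpace G] in
/-- The pinned fine density of a piece is integrable (integrable old piece, bounded measurable cofactor on the graph). [folklore] -/
theorem integrable_finePiece (havg : Measurable avg) (χk T : Seq D k → Density P k G)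
    (χk1 : Seq D (k + 1) → Density P (k + 1) G) (w : Seq D (k + 1) → GaugeField P k G → GaugeField P (k + 1) G → ℝ)
    (s' : Seq D (k + 1)) (hT : Integrable (fun U => χk s'.init U * T s'.init U) (fieldMeasure P k G))
    (hw : Measurable (fun z : GaugeField P (k + 1) G × GaugeField P k G => w s' z.2 z.1))
    (hwb : ∀ U V', |w s' U V'| ≤ 1) (hχ : Measurable (χk1 s')) (hχb : ∀ V', |χk1 s' V'| ≤ 1)
    {M : GaugeField P (k + 1) G → ℝ} (hM : Measurable M) {C : ℝ} (hMC : ∀ V', |M V'| ≤ C) :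
    Integrable (fun U => M (avg U) * (χk1 s' (avg U) * w s' U (avg U)) * (χk s'.init U * T s'.init U))
      (fieldMeasure P k G) := by
  have hb : Measurable (fun z : GaugeField P (k + 1) G × GaugeField P k G => w s' z.2 z.1 * (χk1 s' z.1 * M z.1)) :=
    hw.mul ((hχ.comp measurable_fst).mul (hM.comp measurable_fst))
  have hbC : ∀ z : GaugeField P (k + 1) G × GaugeField P k G, ‖w s' z.2 z.1 * (χk1 s' z.1 * M z.1)‖ ≤ C := by
    intro z
    rw [Real.norm_eq_abs, abs_mul, abs_mul]
    calc |w s' z.2 z.1| * (|χk1 s' z.1| * |M z.1|) ≤ 1 * (1 * C) :=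
          mul_le_mul (hwb _ _) (mul_le_mul (hχb _) (hMC _) (abs_nonneg _) zero_le_one)
            (mul_nonneg (abs_nonneg _) (abs_nonneg _)) zero_le_one
      _ = C := by ring
  refine (integrable_graph_piece havg hT hb hbC).congr (ae_of_all _ fun U => ?_)
  show (χk s'.init U * T s'.init U) * (w s' U (avg U) * (χk1 s' (avg U) * M (avg U))) = _
  ring

/-- **«LCS-j» FOR A LEVEL-`(k+1)` PIECE IS THE FINE-LEVEL MOMENT AGAINST THE PINNED FINE DENSITY.**  For a bounded measurable coarse carrier
`M`, the `LocCondStability` inequality for the piece `χ_{k+1}(s′)·texpASucc(s′)` — `∫ M·piece dV′ ≤ e^{b}·∫ piece dV′` — holds IF AND ONLY IF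
`∫ M(Ū)·f(U) dU ≤ e^{b}·∫ f(U) dU` for the pinned fine density `f(U) = χ_{k+1}(s′)(Ū)·w(s′)(U,Ū)·χ_k(init s′)(U)·T(init s′)(U)` (both sides are
literally equal). [folklore] -/
theorem lcs_piece_iff_fine (havg : Measurable avg) (hac : HaarAC avg) (χk T : Seq D k → Density P k G)
    (χk1 : Seq D (k + 1) → Density P (k + 1) G) (w : Seq D (k + 1) → GaugeField P k G → GaugeField P (k + 1) G → ℝ)
    (s' : Seq D (k + 1)) (hT : Integrable (fun U => χk s'.init U * T s'.init U) (fieldMeasure P k G))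
    (hw : Measurable (fun z : GaugeField P (k + 1) G × GaugeField P k G => w s' z.2 z.1))
    (hwb : ∀ U V', |w s' U V'| ≤ 1) (hχ : Measurable (χk1 s')) (hχb : ∀ V', |χk1 s' V'| ≤ 1)
    {M : GaugeField P (k + 1) G → ℝ} (hM : Measurable M) {C : ℝ} (hMC : ∀ V', |M V'| ≤ C) (b : ℝ) :
    ∫ V', M V' * (χk1 s' V' * texpASucc avg χk T w s' V') ∂(fieldMeasure P (k + 1) G) ≤
        Real.exp b * ∫ V', χk1 s' V' * texpASucc avg χk T w s' V' ∂(fieldMeasure P (k + 1) G) ↔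
      ∫ U, M (avg U) * (χk1 s' (avg U) * w s' U (avg U)) * (χk s'.init U * T s'.init U) ∂(fieldMeasure P k G) ≤
        Real.exp b * ∫ U, (χk1 s' (avg U) * w s' U (avg U)) * (χk s'.init U * T s'.init U) ∂(fieldMeasure P k G) := by
  rw [integral_mul_piece_texpASucc havg hac χk T χk1 w s' hT hw hwb hχ hχb hM hMC,
    integral_piece_texpASucc havg hac χk T χk1 w s' hT hw hwb hχ hχb]

/-- **A CARRIER BOUND ON THE SUPPORT OF THE PINNED FINE DENSITY SUFFICES** (record-level twin of `…NE7b.CarrierOnSupport`): if the pinned fine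
density `f` is non-negative and `M(Ū) ≤ e^{b}` wherever `f(U) ≠ 0` — the new front factor `χ_{k+1}(s′)(Ū)` inside `f` restricts the averaged
field to the sequence's small-field domains, so nothing is asked off them —, then the `LocCondStability` inequality holds for the piece.
[folklore] -/
theorem lcs_piece_of_carrier_le_on_support (havg : Measurable avg) (hac : HaarAC avg) (χk T : Seq D k → Density P k G)
    (χk1 : Seq D (k + 1) → Density P (k + 1) G) (w : Seq D (k + 1) → GaugeField P k G → GaugeField P (k + 1) G → ℝ)
    (s' : Seq D (k + 1)) (hT : Integrable (fun U => χk s'.init U * T s'.init U) (fieldMeasure P k G))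
    (hw : Measurable (fun z : GaugeField P (k + 1) G × GaugeField P k G => w s' z.2 z.1))
    (hwb : ∀ U V', |w s' U V'| ≤ 1) (hχ : Measurable (χk1 s')) (hχb : ∀ V', |χk1 s' V'| ≤ 1)
    {M : GaugeField P (k + 1) G → ℝ} (hM : Measurable M) {C : ℝ} (hMC : ∀ V', |M V'| ≤ C) {b : ℝ}
    (h0 : ∀ U, 0 ≤ (χk1 s' (avg U) * w s' U (avg U)) * (χk s'.init U * T s'.init U))
    (hMb : ∀ U, (χk1 s' (avg U) * w s' U (avg U)) * (χk s'.init U * T s'.init U) ≠ 0 → M (avg U) ≤ Real.exp b) :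
    ∫ V', M V' * (χk1 s' V' * texpASucc avg χk T w s' V') ∂(fieldMeasure P (k + 1) G) ≤
      Real.exp b * ∫ V', χk1 s' V' * texpASucc avg χk T w s' V' ∂(fieldMeasure P (k + 1) G) := by
  rw [lcs_piece_iff_fine havg hac χk T χk1 w s' hT hw hwb hχ hχb hM hMC b]
  have hMf := integrable_finePiece havg χk T χk1 w s' hT hw hwb hχ hχb hM hMC
  have hf : Integrable (fun U => (χk1 s' (avg U) * w s' U (avg U)) * (χk s'.init U * T s'.init U)) (fieldMeasure P k G) := by
    have h := integrable_finePiece havg χk T χk1 w s' hT hw hwb hχ hχb (M := fun _ => (1 : ℝ)) measurable_const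
      (C := 1) (fun _ => by simp)
    simpa only [one_mul] using h
  calc ∫ U, M (avg U) * (χk1 s' (avg U) * w s' U (avg U)) * (χk s'.init U * T s'.init U) ∂(fieldMeasure P k G)
      ≤ ∫ U, Real.exp b * ((χk1 s' (avg U) * w s' U (avg U)) * (χk s'.init U * T s'.init U)) ∂(fieldMeasure P k G) := by
        refine integral_mono hMf (hf.const_mul _) fun U => ?_
        by_cases hz : (χk1 s' (avg U) * w s' U (avg U)) * (χk s'.init U * T s'.init U) = 0
        · have : M (avg U) * (χk1 s' (avg U) * w s' U (avg U)) * (χk s'.init U * T s'.init U) = 0 := by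
            rw [mul_assoc, hz, mul_zero]
          simp only [this, hz, mul_zero, le_refl]
        · rw [mul_assoc]
          exact mul_le_mul_of_nonneg_right (hMb U hz) (h0 U)
    _ = Real.exp b * ∫ U, (χk1 s' (avg U) * w s' U (avg U)) * (χk s'.init U * T s'.init U) ∂(fieldMeasure P k G) :=
        integral_const_mul _ _

end Generic

/-! ## §2 Of record: `G = SU(N)`, Bałaban's averaging `avOfRecord`, def-R's front factors `chiSeqOfRecord`, the T-step `tstepOfRecord` -/

section OfRecord

variable (F : T4Family) (N : ℕ) [NeZero N] (ν : Stage7Numerics) (Mν : ℕ) (w : StepWeightsOfRecord F N ν Mν)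
  (p : B12.RunParams) (g : ℕ → ℝ) (k : ℕ)

/-- **WHERE THE (α)-INSTANCE MEETS THE RECORD.**  For NODE 00's T-step of record at a performed level `k < K`, a bounded measurable coarse
carrier `M` and a new sequence `s′` of record (with the displayed provisos of `isRT_tstepOfRecord` for that sequence: integrable old piece,
bounded jointly measurable step weight, measurable new front factor):
`∫ M(V′)·χ_{k+1}(s′)(V′)·(tstepOfRecord … T s′)(V′) dV′ = ∫ M(Ū)·(χ_{k+1}(s′)(Ū)·w(s′)(U,Ū))·(χ_k(init s′)(U)·T(init s′)(U)) dU`,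
`Ū = (avOfRecord F N K k).avg U` Bałaban's block average of record. [folklore] -/
theorem integral_mul_piece_tstepOfRecord (hk : k < p.K)
    (T : SeqOfRecord F ν Mν g p.K k → Density (F.P p.K) k (SU N)) (s' : SeqOfRecord F ν Mν g p.K (k + 1))
    (hT : Integrable (fun U => chiSeqOfRecord F N ν Mν g p.K k s'.init U * T s'.init U) (fieldMeasure (F.P p.K) k (SU N)))
    (hw : Measurable
      (fun z : GaugeField (F.P p.K) (k + 1) (SU N) × GaugeField (F.P p.K) k (SU N) => w p g k s' z.2 z.1))
    (hwb : ∀ U V', |w p g k s' U V'| ≤ 1) (hχ : Measurable (chiSeqOfRecord F N ν Mν g p.K (k + 1) s'))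
    {M : GaugeField (F.P p.K) (k + 1) (SU N) → ℝ} (hM : Measurable M) {C : ℝ} (hMC : ∀ V', |M V'| ≤ C) :
    ∫ V', M V' * (chiSeqOfRecord F N ν Mν g p.K (k + 1) s' V' * tstepOfRecord F N ν Mν w p g k T s' V')
        ∂(fieldMeasure (F.P p.K) (k + 1) (SU N)) =
      ∫ U, M ((avOfRecord F N p.K k).avg U) *
          (chiSeqOfRecord F N ν Mν g p.K (k + 1) s' ((avOfRecord F N p.K k).avg U) *
            w p g k s' U ((avOfRecord F N p.K k).avg U)) *
          (chiSeqOfRecord F N ν Mν g p.K k s'.init U * T s'.init U) ∂(fieldMeasure (F.P p.K) k (SU N)) :=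
  integral_mul_piece_texpASucc (avOfRecord_measurable F N p.K k) (avOfRecord_haarAC F N p.K k hk) _ T _ (w p g k) s'
    hT hw hwb hχ (fun V' => abs_chiSeqOfRecord_le_one F N ν Mν g p.K (k + 1) s' V') hM hMC

/-- **«LCS-j» AT LEVEL `k+1` OF THE REPRESENTED TOWER OF RECORD, PIECE BY PIECE, IS A FINE-LEVEL MOMENT AGAINST THE PINNED FINE DENSITY.**
For the piece of the new sequence `s′` of NODE 00's T-step of record (`k < K`), the `LocCondStability` inequality with a bounded measurable
coarse carrier `M` and exponent `b` holds IF AND ONLY IF the composed carrier `M ∘ avOfRecord` has moment `≤ e^{b}` against the pinned fine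
density `χ_{k+1}(s′)(Ū)·w(s′)(U,Ū)·χ_k(init s′)(U)·T(init s′)(U)`.  For `T =` the tower's level-`k` slot (`Node00.RepTowerOfRecord.slotsOfRecord`)
these are the pieces of `𝐓ρ_k` of record (`trhoOfRecord9`); the estimate itself is the (α)-instance's content (module 2 proves its analogue for
decimation; for `avOfRecord` it is located residual (i)∕(ii) of module 1). [folklore] -/
theorem lcs_piece_tstepOfRecord_iff (hk : k < p.K)
    (T : SeqOfRecord F ν Mν g p.K k → Density (F.P p.K) k (SU N)) (s' : SeqOfRecord F ν Mν g p.K (k + 1))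
    (hT : Integrable (fun U => chiSeqOfRecord F N ν Mν g p.K k s'.init U * T s'.init U) (fieldMeasure (F.P p.K) k (SU N)))
    (hw : Measurable
      (fun z : GaugeField (F.P p.K) (k + 1) (SU N) × GaugeField (F.P p.K) k (SU N) => w p g k s' z.2 z.1))
    (hwb : ∀ U V', |w p g k s' U V'| ≤ 1) (hχ : Measurable (chiSeqOfRecord F N ν Mν g p.K (k + 1) s'))
    {M : GaugeField (F.P p.K) (k + 1) (SU N) → ℝ} (hM : Measurable M) {C : ℝ} (hMC : ∀ V', |M V'| ≤ C) (b : ℝ) :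
    ∫ V', M V' * (chiSeqOfRecord F N ν Mν g p.K (k + 1) s' V' * tstepOfRecord F N ν Mν w p g k T s' V')
          ∂(fieldMeasure (F.P p.K) (k + 1) (SU N)) ≤
        Real.exp b * ∫ V', chiSeqOfRecord F N ν Mν g p.K (k + 1) s' V' * tstepOfRecord F N ν Mν w p g k T s' V'
          ∂(fieldMeasure (F.P p.K) (k + 1) (SU N)) ↔
      ∫ U, M ((avOfRecord F N p.K k).avg U) *
            (chiSeqOfRecord F N ν Mν g p.K (k + 1) s' ((avOfRecord F N p.K k).avg U) *
              w p g k s' U ((avOfRecord F N p.K k).avg U)) *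
            (chiSeqOfRecord F N ν Mν g p.K k s'.init U * T s'.init U) ∂(fieldMeasure (F.P p.K) k (SU N)) ≤
        Real.exp b * ∫ U, (chiSeqOfRecord F N ν Mν g p.K (k + 1) s' ((avOfRecord F N p.K k).avg U) *
              w p g k s' U ((avOfRecord F N p.K k).avg U)) *
            (chiSeqOfRecord F N ν Mν g p.K k s'.init U * T s'.init U) ∂(fieldMeasure (F.P p.K) k (SU N)) :=
  lcs_piece_iff_fine (avOfRecord_measurable F N p.K k) (avOfRecord_haarAC F N p.K k hk) _ T _ (w p g k) s'
    hT hw hwb hχ (fun V' => abs_chiSeqOfRecord_le_one F N ν Mν g p.K (k + 1) s' V') hM hMC b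

/-- **THE SMALL-FIELD READING AT THE RECORD**: a bound `M(Ū) ≤ e^{b}` on the support of the (non-negative) pinned fine density of the sequence
`s′` gives the `LocCondStability` inequality for its piece of the T-step of record. [folklore] -/
theorem lcs_piece_tstepOfRecord_of_carrier_le_on_support (hk : k < p.K)
    (T : SeqOfRecord F ν Mν g p.K k → Density (F.P p.K) k (SU N)) (s' : SeqOfRecord F ν Mν g p.K (k + 1))
    (hT : Integrable (fun U => chiSeqOfRecord F N ν Mν g p.K k s'.init U * T s'.init U) (fieldMeasure (F.P p.K) k (SU N)))
    (hw : Measurable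
      (fun z : GaugeField (F.P p.K) (k + 1) (SU N) × GaugeField (F.P p.K) k (SU N) => w p g k s' z.2 z.1))
    (hwb : ∀ U V', |w p g k s' U V'| ≤ 1) (hχ : Measurable (chiSeqOfRecord F N ν Mν g p.K (k + 1) s'))
    {M : GaugeField (F.P p.K) (k + 1) (SU N) → ℝ} (hM : Measurable M) {C : ℝ} (hMC : ∀ V', |M V'| ≤ C) {b : ℝ}
    (h0 : ∀ U, 0 ≤ (chiSeqOfRecord F N ν Mν g p.K (k + 1) s' ((avOfRecord F N p.K k).avg U) *
        w p g k s' U ((avOfRecord F N p.K k).avg U)) * (chiSeqOfRecord F N ν Mν g p.K k s'.init U * T s'.init U))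
    (hMb : ∀ U, (chiSeqOfRecord F N ν Mν g p.K (k + 1) s' ((avOfRecord F N p.K k).avg U) *
        w p g k s' U ((avOfRecord F N p.K k).avg U)) * (chiSeqOfRecord F N ν Mν g p.K k s'.init U * T s'.init U) ≠ 0 →
        M ((avOfRecord F N p.K k).avg U) ≤ Real.exp b) :
    ∫ V', M V' * (chiSeqOfRecord F N ν Mν g p.K (k + 1) s' V' * tstepOfRecord F N ν Mν w p g k T s' V')
        ∂(fieldMeasure (F.P p.K) (k + 1) (SU N)) ≤
      Real.exp b * ∫ V', chiSeqOfRecord F N ν Mν g p.K (k + 1) s' V' * tstepOfRecord F N ν Mν w p g k T s' V'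
        ∂(fieldMeasure (F.P p.K) (k + 1) (SU N)) :=
  lcs_piece_of_carrier_le_on_support (avOfRecord_measurable F N p.K k) (avOfRecord_haarAC F N p.K k hk) _ T _ (w p g k) s'
    hT hw hwb hχ (fun V' => abs_chiSeqOfRecord_le_one F N ν Mν g p.K (k + 1) s' V') hM hMC h0 hMb

end OfRecord

end Summit.QuantumFields.YangMills.BalabanUVNodes.N20LCSAtTStepOfRecord

end
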